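import Literature.NumberTheory.DiophantineGeometry.AbcWave0
import Literature.NumberTheory.LFunctions.SiegelZeroLogDerivCriterion
import Literature.NumberTheory.LFunctions.PrimitiveQuadraticCharacterModulus
import Literature.NumberTheory.QuadraticFields.ReducedForms
import HarnessLib
import Summits.RiemannHypothesis.RiemannHypothesis.Theorems.NoSiegelZerosOddQuadratic

/-!
# Granville–Stark, Theorem 2 (abc.S22): the deduction "Theorem 1 + Selberg–Chowla ⟹ no Siegel
# zeros", proved

Topic `Literature/NumberTheory/DiophantineGeometry`; a proofs-only companion (theorems only, no
definitions, no named facts) of the record `granville_stark_noSiegelZeros :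
UniformABCConjecture → NoSiegelZerosOddQuadratic` of `AbcWave0.lean` (Granville–Stark, *ABC
implies no "Siegel zeros" for L-functions of characters with negative discriminant*, Invent.
Math. 139 (2000), Theorem 2).

The printed proof of Theorem 2 (loc. cit., p. 510–511) is the two-line deduction
"Mahler [11] showed that if (2) holds then the Dirichlet L-function `L(s, χ_d)` … has no real zero
in the interval `1 − c/log d < s ≤ 1` … We can thus deduce: Theorem 2", where (2) is the
conclusion of **Theorem 1** — the uniform abc-conjecture implies
`h(−d) ≥ {π/3 + o(1)} (√d/log d) ∑_{(a,b,c) reduced} 1/a` — and "Mahler's result" is obtained in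
§3.1, Remark 1 from **(11)** (Selberg–Chowla + Dirichlet's class number formula, §3.2):
`(π h(−d)/√d)(L'/L(1, χ_d) + ½ log d) = (π²/6) ∑ 1/a + O((1/√d) ∑ log(√d/a))`, together with
`L'/L(1, χ) = 1/(1 − β) + O(log d)`. This file machine-checks exactly that deduction:

* `noSiegelZerosOddQuadratic_of_logDeriv_le`, `noSiegelZerosOddQuadratic_of_eventually_logDeriv_le`,
  `noSiegelZerosOddQuadratic_iff_logDeriv_le` — the odd-character forms of the Mahler–Granville–Stark
  criterion of `Literature/NumberTheory/LFunctions/SiegelZeroLogDerivCriterion.lean`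
  (`ExceptionalZero.exists_LFunction_ne_zero_of_logDeriv_le`, from MV Lemma 11.1/Theorem 11.3):
  `NoSiegelZerosOddQuadratic ↔ L'/L(1, χ) ≤ A log q` for all odd real primitive `χ` mod `q ≥ 3`;
* `logDeriv_le_of_classNumber_bounds` — the real-variable heart of §3: a lower bound
  `h ≥ (π/6)(√d/log d) S` (Theorem 1 with `o(1)` specialised to `−π/6`) and the upper half of (11),
  `h (L'/L(1, χ) + ½ log d) ≤ (π/6) √d S + A₀ ∑ log(√d/a)`, give `L'/L(1, χ) ≤ (1 + |A₀|) log d`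
  (each `log(√d/a) ∈ [0, ½ log d]` as `1 ≤ a ≤ √(d/3)` for a reduced form,
  `log_sqrt_div_mem_of_mem_reducedForms`);
* `granville_stark_noSiegelZeros_of_thm1_of_eq11` — **Theorem 2 from Theorem 1 and (11)**: if
  the uniform abc-conjecture implies (2) (hypothesis `thm1`, the statement of Theorem 1) and (11)
  holds (hypothesis `eq11`, unconditional in print), then `granville_stark_noSiegelZeros`.

The two hypotheses are displayed, cited statements of the source, NOT restatements of the
conclusion: `thm1` is about class numbers of imaginary quadratic fields and carries all of the
complex-multiplication content of the paper (§2: `j(τ)`, `γ₂`, `γ₃`, Lemma 1 on the root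
discriminant of `k(γ₂(τ), γ₃(τ))` via the ray class field mod `6` and Shimura reciprocity — class
field theory absent from Mathlib and from the tree, cf. the unproved
`Literature.NumberTheory.EllipticCurves.irreducible_classPolynomial`), and `eq11` is the purely
analytic Kronecker-limit-formula identity of §3.2 (Selberg–Chowla [12] summed over the form classes,
with `L(1, χ) = π h(−d)/√d`; the tree has Chowla–Selberg for a single form,
`Literature.Barriers.RiemannHypothesis.BatemanGrosswald1964_thm1_holds`, but neither
`∑_Q Z_Q(s) = 2 ζ(s) L(s, χ_{−d})` nor Dirichlet's class number formula). Under D-0026 neither may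
be minted here as a named fact, so they stay explicit hypotheses of the glue theorem; discharging
them is what remains of abc.S22 (`granville_stark_noSiegelZeros_holds`).

Conventions. `h(−d)` is the form class number
`Literature.NumberTheory.QuadraticFields.BinaryQuadraticForm.classNumber (−d)` (number of reduced
primitive positive definite forms of discriminant `−d`, Cox Thm. 2.13 — Granville–Stark's `h(−d)`,
the class number of `ℚ(√−d)`, for fundamental `−d`), `∑ 1/a` and `∑ log(√d/a)` run over
`reducedForms (−d)` (Granville–Stark: "`−a < b ≤ a < c` or `0 ≤ b ≤ a = c`", Gauss/Cox (2.7)), and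
"`−d` is a fundamental discriminant" is expressed by the datum the conclusion quantifies over — an
odd real primitive character `χ` mod `d`, necessarily the Kronecker symbol `(−d/·)` (Davenport
Ch. 5; MV Thm. 9.13; `PrimitiveQuadratic.neg_emod_four_of_odd` gives `−d ≡ 0, 1 (mod 4)`, whence
`h(−d) ≥ 1`).

## References

* [GranvilleStark2000] A. Granville, H. M. Stark, Invent. Math. 139 (2000), 509–523: Theorem 1 and
  Theorem 2 with the deduction via Mahler (p. 510–511); §3.1 Remark 1 (p. 515); §3.2, eq. (11) and
  the error-term bound (p. 516).
* [Tafula2021] C. Táfula, Acta Arith. 201 (2021), p. 3 (eq. (1.1)–(1.2): the same deduction).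
* [MontgomeryVaughan2007] H. L. Montgomery, R. C. Vaughan, *Multiplicative Number Theory I*,
  Lemma 11.1, Theorem 11.3, Theorem 9.13.
* K. Mahler, J. London Math. Soc. 9 (1934), 298–302; A. Selberg, S. Chowla, J. reine angew. Math.
  227 (1967), 86–110 (cited through [GranvilleStark2000]).
-/

noncomputable section

open Complex Finset

namespace Literature.NumberTheory.DiophantineGeometry

open Literature.NumberTheory.LFunctions Literature.NumberTheory.LFunctions.ExceptionalZero
  Literature.NumberTheory.LFunctions.PrimitiveQuadratic
  Literature.NumberTheory.QuadraticFields.BinaryQuadraticForm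

/-! ### The criterion for odd characters -/

/-- **No Siegel zeros for odd real primitive characters ⟸ `L'/L(1, χ) ≤ A log q`** (all `q ≥ 3`,
all odd quadratic primitive `χ` mod `q`, i.e. the Kronecker symbols `(−q/·)` of the imaginary
quadratic fields): the consequent `NoSiegelZerosOddQuadratic` of Granville–Stark's Theorem 2
follows, with `c = 1/(max A 0 + C₀)` (`ExceptionalZero.exists_LFunction_ne_zero_of_logDeriv_le`).
This is the step "Mahler [11] showed that if (2) holds then … no real zero in
`1 − c/log d < s ≤ 1`" of Granville–Stark, in the `L'/L` form of their §3.1 Remark 1.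
[cite: GranvilleStark2000, §1 (Theorem 2) and §3.1 Remark 1] -/
theorem noSiegelZerosOddQuadratic_of_logDeriv_le
    (h : ∃ A : ℝ, ∀ (q : ℕ) [NeZero q], 3 ≤ q → ∀ χ : DirichletCharacter ℂ q, χ.IsQuadratic →
      χ.IsPrimitive → χ.Odd → (deriv χ.LFunction 1 / χ.LFunction 1).re ≤ A * Real.log q) :
    Summit.RiemannHypothesis.RiemannHypothesis.NoSiegelZerosOddQuadratic := by
  obtain ⟨C₀, hC₀, H⟩ := exists_LFunction_ne_zero_of_logDeriv_le
  obtain ⟨A, hA⟩ := h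
  refine ⟨1 / (max A 0 + C₀), by positivity, fun q _ hq χ hquad hprim hodd σ hσ ↦ ?_⟩
  have hχ : χ ≠ 1 := fun h1 ↦ by
    have hc : χ.conductor = 1 := DirichletCharacter.eq_one_iff_conductor_eq_one.1 h1
    have hq' : χ.conductor = q := hprim
    omega
  have hχ2 : χ ^ 2 = 1 := hquad.sq_eq_one
  have hq3 : (3 : ℝ) ≤ q := by exact_mod_cast hq
  have hLq0 : 0 < Real.log q := Real.log_pos (by linarith)
  have hbound : (deriv χ.LFunction 1 / χ.LFunction 1).re ≤ max A 0 * Real.log q :=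
    (hA q hq χ hquad hprim hodd).trans (mul_le_mul_of_nonneg_right (le_max_left _ _) hLq0.le)
  refine H (max A 0) (le_max_right _ _) q χ hχ hχ2 (by omega)
    (deriv_re_le_of_logDeriv_re_le χ hχ hχ2 hbound) σ ?_
  rwa [div_div] at hσ

/-- **Sufficiently large moduli suffice** (odd characters): if `Re L'/L(1, χ) ≤ A log q` for all
`q ≥ q₀` and all odd quadratic primitive `χ` mod `q`, then `NoSiegelZerosOddQuadratic` (the
finitely many `3 ≤ q < q₀` are absorbed into the constant,
`ExceptionalZero.exists_forall_lt_logDeriv_le`). This is the form in which Granville–Stark's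
Theorem 1 (with (11)) yields Theorem 2: under the uniform abc-conjecture,
`L'/L(1, χ_{−d}) = O(log d)` as `d → ∞`. [cite: GranvilleStark2000, §1 (Theorem 2) and §3.1 Remark 1] -/
theorem noSiegelZerosOddQuadratic_of_eventually_logDeriv_le
    (h : ∃ A : ℝ, ∃ q₀ : ℕ, ∀ (q : ℕ) [NeZero q], q₀ ≤ q → 3 ≤ q → ∀ χ : DirichletCharacter ℂ q,
      χ.IsQuadratic → χ.IsPrimitive → χ.Odd →
        (deriv χ.LFunction 1 / χ.LFunction 1).re ≤ A * Real.log q) :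
    Summit.RiemannHypothesis.RiemannHypothesis.NoSiegelZerosOddQuadratic := by
  obtain ⟨A, q₀, hA⟩ := h
  obtain ⟨B, hB⟩ := exists_forall_lt_logDeriv_le q₀
  refine noSiegelZerosOddQuadratic_of_logDeriv_le ⟨max A B, fun q _ hq χ hquad hprim hodd ↦ ?_⟩
  have hq3 : (3 : ℝ) ≤ q := by exact_mod_cast hq
  have hLq0 : 0 < Real.log q := Real.log_pos (by linarith)
  rcases lt_or_ge q q₀ with hlt | hge
  · exact (hB q hlt (by omega) χ).trans (mul_le_mul_of_nonneg_right (le_max_right _ _) hLq0.le)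
  · exact (hA q hge hq χ hquad hprim hodd).trans
      (mul_le_mul_of_nonneg_right (le_max_left _ _) hLq0.le)

/-- **The equivalence, odd characters** (Granville–Stark §3.1 Remark 1; Táfula 2021, p. 3:
"`|L'/L(1, χ_D)| ≪ log|D|`, which is equivalent to `L(s, χ_D)` having no Siegel zeros"):
`NoSiegelZerosOddQuadratic ↔ ∃ A, ∀ q ≥ 3, ∀ χ` odd quadratic primitive mod `q`,
`Re L'/L(1, χ) ≤ A log q`. [cite: GranvilleStark2000, §3.1 Remark 1] -/
theorem noSiegelZerosOddQuadratic_iff_logDeriv_le :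
    Summit.RiemannHypothesis.RiemannHypothesis.NoSiegelZerosOddQuadratic ↔
      ∃ A : ℝ, ∀ (q : ℕ) [NeZero q], 3 ≤ q → ∀ χ : DirichletCharacter ℂ q,
        χ.IsQuadratic → χ.IsPrimitive → χ.Odd →
          (deriv χ.LFunction 1 / χ.LFunction 1).re ≤ A * Real.log q := by
  refine ⟨fun ⟨c, hc, hfree⟩ ↦ ?_, noSiegelZerosOddQuadratic_of_logDeriv_le⟩
  obtain ⟨A₁, A₂, hA₁, hA₂, H⟩ := exists_logDeriv_le_of_LFunction_ne_zero
  refine ⟨A₁ + A₂ / min c 1, fun q _ hq χ hquad hprim hodd ↦ ?_⟩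
  have hχ : χ ≠ 1 := fun h1 ↦ by
    have hc : χ.conductor = 1 := DirichletCharacter.eq_one_iff_conductor_eq_one.1 h1
    have hq' : χ.conductor = q := hprim
    omega
  have hq3 : (3 : ℝ) ≤ q := by exact_mod_cast hq
  have hLq0 : 0 < Real.log q := Real.log_pos (by linarith)
  refine H (min c 1) (lt_min hc one_pos) (min_le_right _ _) q χ hχ (by omega) fun σ hσ _ ↦ ?_
  refine hfree q hq χ hquad hprim hodd σ (lt_of_le_of_lt ?_ hσ)
  gcongr
  exact min_le_left _ _

/-! ### Reduced forms of discriminant `−d`: `1 ≤ a ≤ √(d/3)` -/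

/-- For a reduced form `(a, b, c)` of discriminant `−d < 0`: `1 ≤ a` and `3a² ≤ d`
(`|b| ≤ a ≤ c` gives `d = 4ac − b² ≥ 4a² − a²`; Gauss, cf. Granville–Stark: "Gauss [6] showed
that there is a representative … with `a ≤ √(d/3)`"). [folklore] -/
theorem one_le_and_three_mul_sq_le_of_mem_reducedForms {d : ℕ} (hd : 0 < d) {Q : ℤ × ℤ × ℤ}
    (hQ : Q ∈ reducedForms (-(d : ℤ))) : 1 ≤ Q.1 ∧ 3 * Q.1 ^ 2 ≤ d := by
  have hD : (-(d : ℤ)) < 0 := by omega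
  obtain ⟨hdisc, ha, -, hred⟩ := (mem_reducedForms_iff hD).1 hQ
  obtain ⟨a, b, c⟩ := Q
  obtain ⟨h1, h2, h3, -⟩ := hred
  simp only at ha h1 h2 h3 ⊢
  rw [discr_apply] at hdisc
  refine ⟨ha, ?_⟩
  have hb : b ^ 2 ≤ a ^ 2 := by nlinarith
  nlinarith

/-- For a reduced form `(a, b, c)` of discriminant `−d < 0`, `0 ≤ log(√d/a) ≤ ½ log d`
(as `1 ≤ a ≤ √(d/3) ≤ √d`). [folklore] -/
theorem log_sqrt_div_mem_of_mem_reducedForms {d : ℕ} (hd : 0 < d) {Q : ℤ × ℤ × ℤ}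
    (hQ : Q ∈ reducedForms (-(d : ℤ))) :
    0 ≤ Real.log (Real.sqrt d / (Q.1 : ℝ)) ∧
      Real.log (Real.sqrt d / (Q.1 : ℝ)) ≤ Real.log d / 2 := by
  obtain ⟨ha1, h3⟩ := one_le_and_three_mul_sq_le_of_mem_reducedForms hd hQ
  have ha1' : (1 : ℝ) ≤ Q.1 := by exact_mod_cast ha1
  have ha0 : (0 : ℝ) < Q.1 := by linarith
  have hdpos : (0 : ℝ) < d := by exact_mod_cast hd
  have hsqrt : 0 < Real.sqrt d := Real.sqrt_pos.2 hdpos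
  have hale : (Q.1 : ℝ) ≤ Real.sqrt d := by
    have h3' : (3 : ℝ) * (Q.1 : ℝ) ^ 2 ≤ d := by exact_mod_cast h3
    have hsq : (Q.1 : ℝ) ^ 2 ≤ d := by nlinarith
    calc (Q.1 : ℝ) = Real.sqrt ((Q.1 : ℝ) ^ 2) := (Real.sqrt_sq ha0.le).symm
      _ ≤ Real.sqrt d := Real.sqrt_le_sqrt hsq
  constructor
  · exact Real.log_nonneg ((one_le_div ha0).2 hale)
  · calc Real.log (Real.sqrt d / Q.1) ≤ Real.log (Real.sqrt d) :=
          Real.log_le_log (by positivity) (div_le_self hsqrt.le ha1')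
      _ = Real.log d / 2 := Real.log_sqrt hdpos.le

/-! ### The real-variable deduction of §3: `L'/L(1, χ) ≪ log d` from the two class-number bounds -/

/-- **From the two class-number inequalities to `L'/L(1, χ) ≪ log d`.** Let `d ≥ 3`, let `h > 0`
be the number of reduced forms of discriminant `−d`, `S = ∑ 1/a`, `E = ∑ log(√d/a)` over them,
and `L ∈ ℝ`. If `(π/6)(√d/log d) S ≤ h` (Theorem 1 with `o(1) ≥ −π/6`) and
`h (L + ½ log d) ≤ (π/6) √d S + A₀ E` (the upper half of (11)), then `L ≤ (1 + |A₀|) log d`: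
indeed `(π/6)√d S ≤ h log d` and `0 ≤ E ≤ ½ h log d`. This is the computation of
Granville–Stark §3.1, Remark 1 / Táfula (1.1)–(1.2) with the explicit formula for `h(−d)`
replaced by the two inequalities it is used through. [cite: GranvilleStark2000, §3.1 Remark 1 and §3.2 eq. (11)] -/
theorem logDeriv_le_of_classNumber_bounds {d : ℕ} (hd : 3 ≤ d) {L A₀ : ℝ}
    (hh : 0 < classNumber (-(d : ℤ)))
    (hlow : Real.pi / 6 * (Real.sqrt d / Real.log d) *
        ∑ Q ∈ reducedForms (-(d : ℤ)), (1 : ℝ) / (Q.1 : ℝ) ≤ classNumber (-(d : ℤ)))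
    (hup : (classNumber (-(d : ℤ)) : ℝ) * (L + Real.log d / 2) ≤
        Real.pi / 6 * Real.sqrt d * ∑ Q ∈ reducedForms (-(d : ℤ)), (1 : ℝ) / (Q.1 : ℝ) +
          A₀ * ∑ Q ∈ reducedForms (-(d : ℤ)), Real.log (Real.sqrt d / (Q.1 : ℝ))) :
    L ≤ (1 + |A₀|) * Real.log d := by
  have hd0 : 0 < d := by omega
  have hd3 : (3 : ℝ) ≤ d := by exact_mod_cast hd
  have hlog : 0 < Real.log d := Real.log_pos (by linarith)
  set S : ℝ := ∑ Q ∈ reducedForms (-(d : ℤ)), (1 : ℝ) / (Q.1 : ℝ) with hSdef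
  set E : ℝ := ∑ Q ∈ reducedForms (-(d : ℤ)), Real.log (Real.sqrt d / (Q.1 : ℝ)) with hEdef
  set h : ℝ := (classNumber (-(d : ℤ)) : ℝ) with hhdef
  have hhpos : 0 < h := by rw [hhdef]; exact_mod_cast hh
  -- `0 ≤ E ≤ h log d / 2`
  have hE0 : 0 ≤ E :=
    sum_nonneg fun Q hQ ↦ (log_sqrt_div_mem_of_mem_reducedForms hd0 hQ).1
  have hE : E ≤ h * (Real.log d / 2) := by
    calc E ≤ ∑ Q ∈ reducedForms (-(d : ℤ)), Real.log d / 2 :=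
          sum_le_sum fun Q hQ ↦ (log_sqrt_div_mem_of_mem_reducedForms hd0 hQ).2
      _ = h * (Real.log d / 2) := by rw [sum_const, nsmul_eq_mul, hhdef]; rfl
  -- `(π/6) √d S ≤ h log d`
  have hT : Real.pi / 6 * Real.sqrt d * S ≤ h * Real.log d := by
    have : Real.pi / 6 * (Real.sqrt d / Real.log d) * S = (Real.pi / 6 * Real.sqrt d * S) / Real.log d := by
      ring
    rw [this, div_le_iff₀ hlog] at hlow
    exact hlow
  -- `A₀ E ≤ |A₀| h log d / 2`
  have hA : A₀ * E ≤ |A₀| * (h * (Real.log d / 2)) :=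
    (mul_le_mul_of_nonneg_right (le_abs_self A₀) hE0).trans (mul_le_mul_of_nonneg_left hE (abs_nonneg _))
  -- combine and divide by `h`
  have hcomb : h * (L + Real.log d / 2) ≤ h * (Real.log d + |A₀| * (Real.log d / 2)) := by
    calc h * (L + Real.log d / 2) ≤ Real.pi / 6 * Real.sqrt d * S + A₀ * E := hup
      _ ≤ h * Real.log d + |A₀| * (h * (Real.log d / 2)) := add_le_add hT hA
      _ = h * (Real.log d + |A₀| * (Real.log d / 2)) := by ring
  have hdiv : L + Real.log d / 2 ≤ Real.log d + |A₀| * (Real.log d / 2) :=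
    le_of_mul_le_mul_left hcomb hhpos
  have habs : 0 ≤ |A₀| := abs_nonneg _
  nlinarith

/-! ### Theorem 2 from Theorem 1 and (11) -/

/-- **Granville–Stark's Theorem 2 from their Theorem 1 and eq. (11)** (abc.S22). Hypotheses, both
displayed statements of the source:

* `thm1` — **Theorem 1** (p. 510): the uniform abc-conjecture for number fields implies
  `h(−d) ≥ {π/3 + o(1)} (√d/log d) ∑_{(a,b,c) reduced} 1/a` as `d → ∞` through the fundamental
  discriminants `−d < 0`, i.e. for every `δ > 0` and all large `d` carrying an odd real primitive
  character (equivalently, `−d` fundamental), `(π/3 − δ)(√d/log d) ∑ 1/a ≤ h(−d)`;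
* `eq11` — **eq. (11)** (p. 516, from the Selberg–Chowla formula [12] and Dirichlet's
  `L(1, χ_d) = π h(−d)/√d`), multiplied through by `√d/π`:
  `|h(−d)(L'/L(1, χ_d) + ½ log d) − (π/6) √d ∑ 1/a| ≤ A₀ ∑_{(a,b,c) reduced} log(√d/a)`
  for all large `d` and the odd real primitive character `χ_d` mod `d`.

Conclusion: `granville_stark_noSiegelZeros`, i.e. `UniformABCConjecture → NoSiegelZerosOddQuadratic`.
Proof as printed (p. 511 and §3.1 Remark 1): under uniform abc, `thm1` (with `δ = π/6`) and `eq11`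
give `L'/L(1, χ_d) ≤ (1 + |A₀|) log d` for large `d` (`logDeriv_le_of_classNumber_bounds`; `h(−d) ≥ 1`
by `PrimitiveQuadratic.neg_emod_four_of_odd` and `classNumber_pos`), and the Mahler–Granville–Stark
criterion `noSiegelZerosOddQuadratic_of_eventually_logDeriv_le` excludes real zeros in
`(1 − c/log d, 1)`. What is NOT proved here are the two hypotheses (complex multiplication /
class field theory for `thm1`; Kronecker's limit formula over the form classes and the class
number formula for `eq11`). [cite: GranvilleStark2000, Theorem 2 (proof, p. 510–511) with Theorem 1 and eq. (11)] -/
theorem granville_stark_noSiegelZeros_of_thm1_of_eq11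
    (thm1 : UniformABCConjecture → ∀ δ : ℝ, 0 < δ → ∃ d₀ : ℕ, ∀ (d : ℕ) [NeZero d], d₀ ≤ d →
      (∃ χ : DirichletCharacter ℂ d, χ.IsQuadratic ∧ χ.IsPrimitive ∧ χ.Odd) →
        (Real.pi / 3 - δ) * (Real.sqrt d / Real.log d) *
            ∑ Q ∈ reducedForms (-(d : ℤ)), (1 : ℝ) / (Q.1 : ℝ) ≤ classNumber (-(d : ℤ)))
    (eq11 : ∃ A₀ : ℝ, ∃ d₀ : ℕ, ∀ (d : ℕ) [NeZero d], d₀ ≤ d → ∀ χ : DirichletCharacter ℂ d,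
      χ.IsQuadratic → χ.IsPrimitive → χ.Odd →
        |(classNumber (-(d : ℤ)) : ℝ) * ((deriv χ.LFunction 1 / χ.LFunction 1).re + Real.log d / 2) -
            Real.pi / 6 * Real.sqrt d * ∑ Q ∈ reducedForms (-(d : ℤ)), (1 : ℝ) / (Q.1 : ℝ)| ≤
          A₀ * ∑ Q ∈ reducedForms (-(d : ℤ)), Real.log (Real.sqrt d / (Q.1 : ℝ))) :
    granville_stark_noSiegelZeros := by
  intro habc
  obtain ⟨A₀, d₂, h11⟩ := eq11
  obtain ⟨d₁, h1⟩ := thm1 habc (Real.pi / 6) (by positivity)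
  refine noSiegelZerosOddQuadratic_of_eventually_logDeriv_le ⟨1 + |A₀|, max d₁ d₂, ?_⟩
  intro d _ hd0 hd3 χ hquad hprim hodd
  -- `h(−d) ≥ 1`
  have h4 := neg_emod_four_of_odd hprim hquad hodd
  have hh : 0 < classNumber (-(d : ℤ)) := classNumber_pos (by omega) h4
  -- Theorem 1 at `δ = π/6`
  have hlow := h1 d (le_of_max_le_left hd0) ⟨χ, hquad, hprim, hodd⟩
  have hlow' : Real.pi / 6 * (Real.sqrt d / Real.log d) *
      ∑ Q ∈ reducedForms (-(d : ℤ)), (1 : ℝ) / (Q.1 : ℝ) ≤ classNumber (-(d : ℤ)) := by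
    have : Real.pi / 3 - Real.pi / 6 = Real.pi / 6 := by ring
    rwa [this] at hlow
  -- the upper half of (11)
  have h11d := h11 d (le_of_max_le_right hd0) χ hquad hprim hodd
  have hup := (le_abs_self _).trans h11d
  exact logDeriv_le_of_classNumber_bounds hd3 hh hlow' (by linarith)

end Literature.NumberTheory.DiophantineGeometry

end
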